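import Summits.Ventures.Crystal3D.Theorems.StickyWulffConstantGenericWallFloorEndBallBlockerDefs
import Summits.Ventures.Crystal3D.Theorems.StickyWulffConstantGenericWallFloorEndBallClassInterface
import HarnessLib

/-!
# §51 interface — BLOCKERS: a ball blocking an empty slot of a certified end ball sits at one of the SEVEN blocker sites of that slot,
# or is payer-accompanied (crux `GenericWallFloor`, stmt-Ventures-19480, line `WallLedgerG`; 19480-p1 → cf-p1 2026-08-28T21:43Z (3))

HONEST FRAMING. Venture `Summits/Ventures/Crystal3D` (cell `crystal3d-full`), helper `--supports` the crux `GenericWallFloor` of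
`route-Ventures-StickyWulffConstant`, REGISTERED line `WallLedgerG`, open stub `stub_twoSlabAdhesion`.  Rung credit only; F-C1 not moved;
NOT the crux.  Census-free, standard axioms (one `decide +kernel` evaluating `blockerSites 0`); GAP/CLASSIFICATION (`δ ≥ 5/2`) as upstream.

WHY.  An END ball `z` of the walker has «no addable empty slot»: every empty slot site `z + A·slotSite i` carries a BLOCKER `b ∈ X` with
`dist b (site) < 1`.  The §51 universe of CONTACT classes (19480-p1's recommendation 21:43Z, replacing the exploding second-shell recursion:
G1 104 976 … G4 9.55·10⁶ terminal configurations) is «(certified contact set `S`, blocker pattern per empty slot)»; this file supplies the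
kernel side of the blocker pattern.
* `blockerSites_zero` — `blockerSites 0` (slot `(1,1,0)`) = the SEVEN sites `(3,3,0)` (the slot itself), `(1,4,±1), (4,1,±1)` (twin
  contacts of `z`, `|q|² = 18`) and `(4,4,±2)` (twin `√2`-sites, `|q|² = 36`), all at `√(1/3)` from the site; by the cubic symmetry every
  `blockerSites i` has this shape.
* **`blocker_mem_blockerSites_or_payer`** — GAP/CLASS (`δ ≥ 5/2`), `X` `1`-separated, `z ∈ X` with certified slot contacts `z + A·slotSite i`
  (`i ∈ S`) and `deg z ≤ |S| + 1`; `b ∈ X`, `b ≠ z`, within `√3` of `z` and within distance `< 1` of the slot site `z + A·slotSite j`.  Then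
  `b = z + A·pointVec q` for some `q ∈ blockerSites j`, OR `b` has a payer `y ∈ X`, `y ≠ z`, `dist b y ≤ 2`, `deg y ≤ 11`.
  HONEST GAP: blockers at distance `∈ (√3, 2)` from `z` are not covered (universe radius).
WHAT THIS IS NOT: no enumeration of blocker patterns; F-C1 not moved.
-/

noncomputable section

namespace Summit.Ventures.Crystal3D.Theorems

open Summit.Ventures.Crystal3D Finset NearIdentity
open scoped InnerProductSpace

variable {X : Finset (EuclideanSpace ℝ (Fin 3))}

set_option maxRecDepth 200000 in
/-- **The seven blocker sites of the slot `(1,1,0)`.** -/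
theorem blockerSites_zero : blockerSites 0 = {![1, 4, -1], ![1, 4, 1], ![3, 3, 0], ![4, 1, -1], ![4, 1, 1], ![4, 4, -2], ![4, 4, 2]} := by
  decide +kernel

/-- **A blocker of an empty slot is at a blocker site, or payer-accompanied.** -/
theorem blocker_mem_blockerSites_or_payer {δ : ℝ} (hg : KissingGap δ) (hc : KissingClassification δ) (hδ : 5 / 2 ≤ δ)
    (hX : ∀ p ∈ X, ∀ q ∈ X, p ≠ q → 1 ≤ dist p q)
    (A : EuclideanSpace ℝ (Fin 3) ≃ₗᵢ[ℝ] EuclideanSpace ℝ (Fin 3)) {z : EuclideanSpace ℝ (Fin 3)} (hz : z ∈ X)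
    (S : Finset (Fin 12)) (hSX : ∀ i ∈ S, z + A (slotSite i) ∈ X)
    (hdeg : (X.filter fun q => dist z q = 1).card ≤ S.card + 1)
    {b : EuclideanSpace ℝ (Fin 3)} (hb : b ∈ X) (hbz : b ≠ z) (h3 : dist b z ≤ Real.sqrt 3)
    (j : Fin 12) (hnear : dist b (z + A (slotSite j)) < 1) :
    (∃ y ∈ X, y ≠ z ∧ dist b y ≤ 2 ∧ (X.filter fun q => dist y q = 1).card ≤ 11) ∨
    ∃ q ∈ blockerSites j, b = z + A (pointVec q) := by
  rcases mem_menuQ3_or_payer_of_near_endBall hg hc hδ hX A hz S hSX hdeg hb hbz h3 with h | ⟨q, hq, hbq⟩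
  · exact Or.inl h
  right
  refine ⟨q, Finset.mem_filter.2 ⟨hq, ?_, ?_⟩, hbq⟩
  · -- no overlap with the centre: `dist b z ≥ 1`
    have h1 := hX b hb z hz hbz
    have h2 := dist_sq_centre_site A z q
    rw [← hbq, dist_comm] at h2
    have : (18 : ℝ) ≤ (sdot3 q q : ℝ) := by nlinarith [h1, h2]
    exact_mod_cast this
  · -- within `< 1` of the slot site
    have h2 := dist_sq_sites A z q (3 • slotInt j)
    rw [← slotSite_eq_pointVec, ← hbq] at h2
    have h0 : 0 ≤ dist b (z + A (slotSite j)) := dist_nonneg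
    have : (sdot3 (q - 3 • slotInt j) (q - 3 • slotInt j) : ℝ) < 18 := by nlinarith [hnear, h2, h0]
    exact_mod_cast this

end Summit.Ventures.Crystal3D.Theorems

end
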